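import Summits.ResolutionOfSingularities.ResolutionOfSingularities.Theses.FrobeniusClosing
import HarnessLib

/-!
# Crux `NoPeriodicIsolatedAtom` (stmt-ResolutionOfSingularities-16344) — birth skeleton (BC3), line `birth`

Route `ResolutionOfSingularities/FrobeniusClosing`, crux #2 (rank 2, THE CERTIFICATE, difficulty
open-problem): for every prime `p`, every `n ≥ 1` and every field `κ` ALGEBRAIC over `𝔽_p`, no run
`c₀, c₁ = step c₀, …, c_r` (`r ≥ 1`) of the point-blow-up dynamics of a height-one atom
`z^p = a(u₁,…,uₙ)` all of whose states are ISOLATED (`κ[[u]]/(∂a)` finite over `κ`) of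
MULTIPLICITY `p` (cleaned, order `≥ p`) returns to an isomorphic pair:
`¬ PairIso c₀ c_r`, `PairIso c c' :⇔ ∃ φ ∈ Aut_κ κ[[u]], v unit, g, φ(a) = v^p·a' + g^p`
[cite: HauserPerlega2019, §1 p. 3 and §5 (the missing "forced cycle")].

## Named dynamics = the crux's `let`-block, verbatim

The thirteen `let`-bound operators of the route decl (`clean, bl, ord, dv, tr, step, run, ser, pd,
jac, Isol, MultP, PairIso`) are mirrored below as honest `def`s with the prime `p` and the state as
arguments; `named_iff : NoPeriodicIsolatedAtom ↔ Named` holds by `Iff.rfl` (the kernel sees the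
`let`-block and the `def`s as the same term), so every stub is stated over the SAME dynamics as the
crux, readably, and the composition concludes the route decl BY NAME.

## The cut (four named stubs; `NoPeriodicIsolatedAtom_of` PROVED, sorries only inside `stub_*`)

The crux calls itself "decidable per `(p, n, μ-bound)` by two dual searches" over `𝔽_p, 𝔽_{p²},
𝔽_{p³}` with polynomial states. The skeleton types exactly what licenses that reading and what the
searches then have to show, along the one structural fact the route review found (evidence
`ARENA-SHARPENING.md`, refuter 2026-08-16: the arena in dimension `n ≥ 3` is the RIDGE — states of
cleaned order exactly `p`):

* `stub_descent` (TRUE, size L — finite determinacy + finiteness of data): a periodic isolated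
  multiplicity-`p` chain over SOME field algebraic over `𝔽_p` yields one over a FINITE field with a
  POLYNOMIAL start (finitely supported `c₀`). Content: replace `c₀` by a high jet (the `N`-jet of the
  start controls the `(N − mp)`-jet of the `m`-th state: blow-up sends `𝔪^{N+1}` into `(u_i)^{N+1}`,
  division by `u_i^p` costs `p`, translation and cleaning respect the `(u_i)`-adic filtration);
  `Isol`/`MultP` survive jet-closeness beyond `μ + 1` (`𝔪^μ ⊆ (∂a)` + Nakayama) and field
  restriction (flatness of `F[[u]] → κ[[u]]`); the pair isomorphism `φ, v, g` is replaced by its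
  jets and the `𝔪^{M}`-error re-absorbed by RIGHT FINITE DETERMINACY of the isolated end state
  (Boubakri–Greuel–Markwig Cor. 2.4: `μ < ∞ ⇒` right `(2μ − ord + 2)`-determined; the printed proof
  is an `𝔪`-adic substitution argument over ANY field — vendored as
  `Literature.AlgebraicGeometry.Resolution.BoubakriGreuelMarkwig.Cor24` with the paper's standing
  `IsAlgClosed`, to be discharged in the general form); finitely many coefficients in a field
  algebraic over `𝔽_p` generate a FINITE field. This is leak (i) "pair-group determinacy" of the
  route's `ClosingReduction`, isolated as a lemma. [cite: BoubakriGreuelMarkwig2010, Thm. 2.1, Cor. 2.4]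
* `stub_orderWindow` (TRUE, size M — the tangent-cone lemma of the route review): for `n ≥ 3` and ANY
  field, if `c` has multiplicity `p` and its successor `step i τ c` is isolated of multiplicity `p`,
  then `ord (clean c) = p` EXACTLY. Proof on paper: write `a = clean c = F_d + F_{d+1} + …`,
  `d = ord a ≥ p`; the successor is `clean(Σ_k u_i^{k−p} F_k(1, u′ + τ))`. If `d ≥ p + 2` it lies in
  `(u_i²)`, so `(∂) ⊆ (u_i)` has infinite colength (`n ≥ 2`). If `d = p + 1` it is
  `u_i·G(u′) + u_i²·H` with `G = F_{p+1}(1, u′ + τ)` untouched by cleaning, so `(∂) ⊆ (u_i, G)`;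
  multiplicity `p` of the successor kills the monomial `u_i`, i.e. `G(0) = 0`, and then
  `κ[[u]]/(u_i, G) ≅ κ[[u′]]/(G)` is infinite over `κ` because `u′` has `n − 1 ≥ 2` variables
  (`u₁^N, u₂^N ∈ (G)` would make `G` a unit, `u₁` being prime to `u₂`). (For `n = 2` the same
  computation gives order exactly `p + 1` instead: an order-`p` binary state has the successor slice
  `F_p(1, y + τ) − F_p(1, τ)` of degree `< p`.) [cite: HauserPerlega2019, §2–§3 (transform law and
  order behaviour under point blowups); BoubakriGreuelMarkwig2010, §1 (`μ < ∞ ⇔ 𝔪^k ⊆ j(f)`)]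
* `stub_lowDim` (curve and surface atoms, `n ≤ 2`, finite fields, polynomial start: NO periodic
  isolated chain; size M–L). `n = 1`: no translations, each step divides by `u^p`, the order drops
  by `p`, and `PairIso` preserves the cleaned order (`g^p` has only `p`-divisible exponents, a
  cleaned series none) — immediate. `n = 2`: every non-final state has order exactly `p + 1` and a
  transition needs `τ` to be a `p`-fold root of `F_{p+1}(1, y)`; the calibration "no isolated cycles
  for surface atoms" expected from surface theory (route header TWO-LAYER PLAN, `NP_le2`, "first to
  close"). It is the crux restricted to `n ≤ 2` (so exactly as safe as the crux there).
  [cite: Kollar2007, §1.5 and §1.8 (infinitely near singularities of curves), Ch. 2 (surfaces); HauserPerlega2019, §2]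
* `stub_ridgeAcyclic` (THE CERTIFICATE PROPER, open — load-bearing): for `n ≥ 3`, over every FINITE
  field of characteristic `p`, no polynomial start has a periodic isolated multiplicity-`p` chain all
  of whose non-final states have cleaned order exactly `p` (the ridge arena). This is what the rank-2
  compute job decides per `(p, n, q, β)` (cycle search ∥ `E_N = ∅` emptiness certificates), pruned to
  order-`p` states as the review recommends; a cycle found refutes it AND the crux (kill criterion
  (i) of the route). [cite: HauserPerlega2019, §1 p. 3, §5; Varshavsky2014, Thm. 0.1 (why finite
  fields suffice for the closing argument)]
* `NoPeriodicIsolatedAtom_of : Sig.stub_descent → Sig.stub_orderWindow → Sig.stub_lowDim →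
  Sig.stub_ridgeAcyclic → NoPeriodicIsolatedAtom` is PROVED (pure logic over `named_iff`): descend
  the putative periodic chain to a finite field; if `n ≤ 2` apply `stub_lowDim`; if `n ≥ 3` feed
  `stub_orderWindow` at every `m < r` (states `m`, `m + 1` of the descended chain; `run (m+1)` is
  `step (i m) (t m) (run m)` by `rfl`) into `stub_ridgeAcyclic`.

Disproof used: none on file (`ledger crux ls stmt-ResolutionOfSingularities-16344`: no workfiles
before this one — no `Disproof.lean`, no `Negative/` lemma; `ledger negatives --problem
ResolutionOfSingularities` lists nothing on this decl). Dead lines: none recorded for this crux.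
-/

noncomputable section

-- single-problem summit: the doubled namespace component `ResolutionOfSingularities` is forced
set_option linter.dupNamespace false

open Summit.ResolutionOfSingularities.ResolutionOfSingularities.Theses.FrobeniusClosing (NoPeriodicIsolatedAtom)

namespace Summit.ResolutionOfSingularities.ResolutionOfSingularities.Cruxes.NoPeriodicIsolatedAtom.Lines.Birth

open scoped BigOperators Classical

/-! ## The named dynamics (verbatim mirror of the crux's `let`-block; `p` = the prime, states are
coefficient functions `(Fin n → ℕ) → κ`) -/

/-- `p`-CLEANING: delete the monomials all of whose exponents are divisible by `p` (= reduce `a`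
modulo `κ[[u]]^p` for `κ` perfect). Mirror of the crux's `clean`. [cite: HauserPerlega2019, §2 ("cleaning")] -/
def clean (p : ℕ) {n : ℕ} {κ : Type} [Field κ] (c : (Fin n → ℕ) → κ) : (Fin n → ℕ) → κ :=
  fun A => @ite κ (∀ j, p ∣ A j) (Classical.dec _) 0 (c A)

/-- Total transform under the chart-`i` point blow-up `u_i ↦ u_i`, `u_j ↦ u_i u_j (j ≠ i)`.
Mirror of the crux's `bl`. [cite: HauserPerlega2019, §2 (point blowup, `x_j`-chart)] -/
def bl {n : ℕ} {κ : Type} [Field κ] (i : Fin n) (c : (Fin n → ℕ) → κ) : (Fin n → ℕ) → κ :=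
  fun B => @ite κ (Finset.sum (Finset.univ.erase i) (fun j => B j) ≤ B i) (Classical.dec _) (c (Function.update B i (B i - Finset.sum (Finset.univ.erase i) (fun j => B j)))) 0

/-- Order of a coefficient function: the least total degree of a non-zero coefficient (junk `0` at
the zero function). Mirror of the crux's `ord`. [folklore] -/
def ord {n : ℕ} {κ : Type} [Field κ] (c : (Fin n → ℕ) → κ) : ℕ :=
  sInf {m : ℕ | ∃ A, c A ≠ 0 ∧ m = Finset.sum Finset.univ (fun j => A j)}

/-- Division by `u_i ^ s` (exponent shift). Mirror of the crux's `dv`. [folklore] -/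
def dv {n : ℕ} {κ : Type} [Field κ] (i : Fin n) (s : ℕ) (c : (Fin n → ℕ) → κ) : (Fin n → ℕ) → κ :=
  fun B => c (Function.update B i (B i + s))

/-- Translation `u_j ↦ u_j + τ_j (j ≠ i)` to the point `τ` of the exceptional divisor in chart `i`
(a finite sum: after `bl`/`dv` every `u_i`-slice is polynomial of degree `≤ B i + s`). Mirror of the
crux's `tr`. [folklore] -/
def tr {n : ℕ} {κ : Type} [Field κ] (i : Fin n) (τ : Fin n → κ) (s : ℕ) (c : (Fin n → ℕ) → κ) : (Fin n → ℕ) → κ :=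
  fun B => Finset.sum (Fintype.piFinset (fun _ : Fin n => Finset.range (B i + s + 1))) (fun D => @ite κ (D i = 0) (Classical.dec _) (c (B + D) * Finset.prod (Finset.univ.erase i) (fun j => ((Nat.choose (B j + D j) (B j) : ℕ) : κ) * τ j ^ (D j))) 0)

/-- ONE STEP of the point-blow-up dynamics (chart `i`, translation `τ`): clean, blow up the point,
divide by `u_i^p` (when the cleaned order is `≥ p`), translate, clean. Mirror of the crux's `step`.
[cite: HauserPerlega2019, §2 (transform under a point blowup with translations `t_i`)] -/
def step (p : ℕ) {n : ℕ} {κ : Type} [Field κ] (i : Fin n) (τ : Fin n → κ) (c : (Fin n → ℕ) → κ) : (Fin n → ℕ) → κ :=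
  clean p (tr i τ (@ite ℕ (p ≤ ord (clean p c)) (Classical.dec _) p 0) (dv i (@ite ℕ (p ≤ ord (clean p c)) (Classical.dec _) p 0) (bl i (clean p c))))

/-- THE RUN `c_m` from the start `c₀` along the word of charts `i` and translations `t`
(`run 0 = c₀`, `run (m+1) = step (i m) (t m) (run m)` definitionally). Mirror of the crux's `run`. [folklore] -/
def run (p : ℕ) {n : ℕ} {κ : Type} [Field κ] (c₀ : (Fin n → ℕ) → κ) (i : ℕ → Fin n) (t : ℕ → Fin n → κ) (m : ℕ) : (Fin n → ℕ) → κ :=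
  @Nat.rec (fun _ => (Fin n → ℕ) → κ) c₀ (fun m c => step p (i m) (t m) c) m

/-- The cleaned state as a formal power series `a ∈ κ[[u₁,…,uₙ]]`. Mirror of the crux's `ser`. [folklore] -/
def ser (p : ℕ) {n : ℕ} {κ : Type} [Field κ] (c : (Fin n → ℕ) → κ) : MvPowerSeries (Fin n) κ :=
  show MvPowerSeries (Fin n) κ from fun A : Fin n →₀ ℕ => clean p c ⇑A

/-- Formal partial derivative `∂/∂u_i` (coefficientwise `(A_i + 1)·f(A + e_i)`). Mirror of the crux's
`pd`. [folklore] -/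
def pd {n : ℕ} {κ : Type} [Field κ] (i : Fin n) (f : MvPowerSeries (Fin n) κ) : MvPowerSeries (Fin n) κ :=
  show MvPowerSeries (Fin n) κ from fun A : Fin n →₀ ℕ => ((A i + 1 : ℕ) : κ) * f (A + Finsupp.single i 1)

/-- The Jacobian ideal `(∂₁a, …, ∂ₙa)` of the cleaned state. Mirror of the crux's `jac`.
[cite: BoubakriGreuelMarkwig2010, §1 (p. 3)] -/
def jac (p : ℕ) {n : ℕ} {κ : Type} [Field κ] (c : (Fin n → ℕ) → κ) : Ideal (MvPowerSeries (Fin n) κ) :=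
  Ideal.span (Set.range (fun i => pd i (ser p c)))

/-- ISOLATED: the Milnor-type algebra `κ[[u]]/(∂a)` is finite over `κ`. Mirror of the crux's `Isol`.
[cite: BoubakriGreuelMarkwig2010, §1 (p. 3)] -/
def Isol (p : ℕ) {n : ℕ} {κ : Type} [Field κ] (c : (Fin n → ℕ) → κ) : Prop :=
  Module.Finite κ (MvPowerSeries (Fin n) κ ⧸ jac p c)

/-- MULTIPLICITY `p`: the cleaned state is non-zero and all its monomials have degree `≥ p`.
Mirror of the crux's `MultP`. [cite: HauserPerlega2019, §2 (`ord F ≥ p^e`)] -/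
def MultP (p : ℕ) {n : ℕ} {κ : Type} [Field κ] (c : (Fin n → ℕ) → κ) : Prop :=
  (∃ A, clean p c A ≠ 0) ∧ ∀ A, clean p c A ≠ 0 → p ≤ Finset.sum Finset.univ (fun j => A j)

/-- PAIR ISOMORPHISM `(κ[[u]], [a]) ≅ (κ[[u]], [a'])`: `φ(a) = v^p·a' + g^p` for a `κ`-automorphism
`φ` of `κ[[u]]`, a unit `v` and some `g`. Mirror of the crux's `PairIso`. [cite: HauserPerlega2019, §1 and §4 ("the same singularity … a cycle occurs")] -/
def PairIso (p : ℕ) {n : ℕ} {κ : Type} [Field κ] (c c' : (Fin n → ℕ) → κ) : Prop :=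
  ∃ (φ : MvPowerSeries (Fin n) κ ≃ₐ[κ] MvPowerSeries (Fin n) κ) (v g : MvPowerSeries (Fin n) κ), IsUnit v ∧ φ (ser p c) = v ^ p * ser p c' + g ^ p

/-- The crux over the named dynamics (same binders, same order). [cite: HauserPerlega2019, §1 p. 3] -/
def Named : Prop :=
  ∀ p : ℕ, p.Prime → ∀ n : ℕ, 0 < n → ∀ (κ : Type) [Field κ] [Algebra (ZMod p) κ] [Algebra.IsAlgebraic (ZMod p) κ]
    (c₀ : (Fin n → ℕ) → κ) (i : ℕ → Fin n) (t : ℕ → Fin n → κ) (r : ℕ), 0 < r →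
    (∀ m, m ≤ r → Isol p (run p c₀ i t m) ∧ MultP p (run p c₀ i t m)) →
    ¬ PairIso p (run p c₀ i t 0) (run p c₀ i t r)

/-- **The mirror is exact**: the route decl and `Named` are the same proposition definitionally
(the `let`-block ζ-reduces onto the `def`s). [folklore] -/
theorem named_iff : NoPeriodicIsolatedAtom ↔ Named := Iff.rfl

/-! ## The four stub STATEMENTS by name (`Sig.stub_<name>`; the composition takes exactly these) -/

/-- Statement of `stub_descent`: a periodic isolated multiplicity-`p` chain over a field algebraic
over `𝔽_p` descends to one over a FINITE field with POLYNOMIAL (finitely supported) start.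
[cite: BoubakriGreuelMarkwig2010, Cor. 2.4] -/
def Sig.stub_descent : Prop :=
  ∀ p : ℕ, p.Prime → ∀ n : ℕ, 0 < n → ∀ (κ : Type) [Field κ] [Algebra (ZMod p) κ] [Algebra.IsAlgebraic (ZMod p) κ]
    (c₀ : (Fin n → ℕ) → κ) (i : ℕ → Fin n) (t : ℕ → Fin n → κ) (r : ℕ), 0 < r →
    (∀ m, m ≤ r → Isol p (run p c₀ i t m) ∧ MultP p (run p c₀ i t m)) →
    PairIso p (run p c₀ i t 0) (run p c₀ i t r) →
    ∃ (F : Type) (_ : Field F) (_ : Algebra (ZMod p) F) (_ : Finite F)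
      (c₀' : (Fin n → ℕ) → F) (i' : ℕ → Fin n) (t' : ℕ → Fin n → F) (r' : ℕ),
      (Function.support c₀').Finite ∧ 0 < r' ∧
      (∀ m, m ≤ r' → Isol p (run p c₀' i' t' m) ∧ MultP p (run p c₀' i' t' m)) ∧
      PairIso p (run p c₀' i' t' 0) (run p c₀' i' t' r')

/-- Statement of `stub_orderWindow`: in dimension `n ≥ 3`, over any field, a multiplicity-`p` state
whose successor is isolated of multiplicity `p` has cleaned order EXACTLY `p`.
[cite: HauserPerlega2019, §2–§3] -/
def Sig.stub_orderWindow : Prop :=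
  ∀ p : ℕ, p.Prime → ∀ n : ℕ, 3 ≤ n → ∀ (K : Type) [Field K] (c : (Fin n → ℕ) → K) (i : Fin n) (τ : Fin n → K),
    MultP p c → Isol p (step p i τ c) → MultP p (step p i τ c) → ord (clean p c) = p

/-- Statement of `stub_lowDim`: for curve and surface atoms (`n ≤ 2`) over finite fields with
polynomial start there is no periodic isolated multiplicity-`p` chain. [cite: Kollar2007, §1.5, Ch. 2] -/
def Sig.stub_lowDim : Prop :=
  ∀ p : ℕ, p.Prime → ∀ n : ℕ, 0 < n → n ≤ 2 → ∀ (F : Type) [Field F] [Algebra (ZMod p) F] [Finite F]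
    (c₀ : (Fin n → ℕ) → F) (i : ℕ → Fin n) (t : ℕ → Fin n → F) (r : ℕ), (Function.support c₀).Finite → 0 < r →
    (∀ m, m ≤ r → Isol p (run p c₀ i t m) ∧ MultP p (run p c₀ i t m)) →
    ¬ PairIso p (run p c₀ i t 0) (run p c₀ i t r)

/-- Statement of `stub_ridgeAcyclic` (the certificate proper): for `n ≥ 3`, over finite fields with
polynomial start, no periodic isolated multiplicity-`p` chain all of whose non-final states lie on
the ridge (cleaned order exactly `p`). [cite: HauserPerlega2019, §1 p. 3, §5] -/
def Sig.stub_ridgeAcyclic : Prop :=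
  ∀ p : ℕ, p.Prime → ∀ n : ℕ, 3 ≤ n → ∀ (F : Type) [Field F] [Algebra (ZMod p) F] [Finite F]
    (c₀ : (Fin n → ℕ) → F) (i : ℕ → Fin n) (t : ℕ → Fin n → F) (r : ℕ), (Function.support c₀).Finite → 0 < r →
    (∀ m, m ≤ r → Isol p (run p c₀ i t m) ∧ MultP p (run p c₀ i t m)) →
    (∀ m, m < r → ord (clean p (run p c₀ i t m)) = p) →
    ¬ PairIso p (run p c₀ i t 0) (run p c₀ i t r)

/-! ## The stubs -/

/-- **STUB (true, size L) — descent to the finite arena.** Jets of the start control jets of every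
later state (blow-up: `𝔪^{N+1} ↦ (u_i)^{N+1}`, division costs `p`, translation/cleaning respect the
`(u_i)`-adic filtration); `Isol`, `MultP` survive jet-closeness beyond `μ + 1` and field restriction;
the pair isomorphism is replaced by its jets and the error re-absorbed by right finite determinacy of
the isolated end state (BGM Cor. 2.4, valid over any field by the printed proof); finitely many
coefficients algebraic over `𝔽_p` generate a finite field. [cite: BoubakriGreuelMarkwig2010, Thm. 2.1, Cor. 2.4] -/
theorem stub_descent (p : ℕ) (hp : p.Prime) (n : ℕ) (hn : 0 < n) (κ : Type) [Field κ] [Algebra (ZMod p) κ]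
    [Algebra.IsAlgebraic (ZMod p) κ] (c₀ : (Fin n → ℕ) → κ) (i : ℕ → Fin n) (t : ℕ → Fin n → κ) (r : ℕ)
    (hr : 0 < r) (hchain : ∀ m, m ≤ r → Isol p (run p c₀ i t m) ∧ MultP p (run p c₀ i t m))
    (hiso : PairIso p (run p c₀ i t 0) (run p c₀ i t r)) :
    ∃ (F : Type) (_ : Field F) (_ : Algebra (ZMod p) F) (_ : Finite F)
      (c₀' : (Fin n → ℕ) → F) (i' : ℕ → Fin n) (t' : ℕ → Fin n → F) (r' : ℕ),
      (Function.support c₀').Finite ∧ 0 < r' ∧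
      (∀ m, m ≤ r' → Isol p (run p c₀' i' t' m) ∧ MultP p (run p c₀' i' t' m)) ∧
      PairIso p (run p c₀' i' t' 0) (run p c₀' i' t' r') := by
  sorry

/-- **STUB (true, size M) — the order window is `{p}` in dimension `≥ 3`.** If `ord (clean c) ≥ p+2`
the successor lies in `(u_i²)` and `(∂) ⊆ (u_i)` has infinite colength; if `= p+1` the successor is
`u_i·G(u′) + u_i²·H`, multiplicity `p` forces `G(0) = 0`, and `κ[[u]]/(u_i, G) ≅ κ[[u′]]/(G)` is
infinite over `κ` for `n − 1 ≥ 2` variables. [cite: HauserPerlega2019, §2–§3; BoubakriGreuelMarkwig2010, §1] -/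
theorem stub_orderWindow (p : ℕ) (hp : p.Prime) (n : ℕ) (hn : 3 ≤ n) (K : Type) [Field K]
    (c : (Fin n → ℕ) → K) (i : Fin n) (τ : Fin n → K) (hc : MultP p c) (hI : Isol p (step p i τ c))
    (hM : MultP p (step p i τ c)) : ord (clean p c) = p := by
  sorry

/-- **STUB (size M–L) — curve and surface atoms carry no periodic isolated chain** (`n = 1`: the order
drops by `p` at every step while `PairIso` preserves it; `n = 2`: non-final states have order exactly
`p + 1`, transitions need a `p`-fold root of `F_{p+1}(1, y)`; calibration from surface theory).
[cite: Kollar2007, §1.5, §1.8, Ch. 2; HauserPerlega2019, §2] -/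
theorem stub_lowDim (p : ℕ) (hp : p.Prime) (n : ℕ) (hn : 0 < n) (hn2 : n ≤ 2) (F : Type) [Field F]
    [Algebra (ZMod p) F] [Finite F] (c₀ : (Fin n → ℕ) → F) (i : ℕ → Fin n) (t : ℕ → Fin n → F) (r : ℕ)
    (hc₀ : (Function.support c₀).Finite) (hr : 0 < r)
    (hchain : ∀ m, m ≤ r → Isol p (run p c₀ i t m) ∧ MultP p (run p c₀ i t m)) :
    ¬ PairIso p (run p c₀ i t 0) (run p c₀ i t r) := by
  sorry

/-- **STUB (OPEN — the certificate proper, load-bearing): the ridge arena over finite fields is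
acyclic** in every dimension `n ≥ 3`: decided per `(p, n, q, β)` by the route's rank-2 searches
(cycle enumeration ∥ `E_N = ∅` emptiness certificates); a cycle refutes it and the crux.
[cite: HauserPerlega2019, §1 p. 3, §5; Varshavsky2014, Thm. 0.1] -/
theorem stub_ridgeAcyclic (p : ℕ) (hp : p.Prime) (n : ℕ) (hn : 3 ≤ n) (F : Type) [Field F]
    [Algebra (ZMod p) F] [Finite F] (c₀ : (Fin n → ℕ) → F) (i : ℕ → Fin n) (t : ℕ → Fin n → F) (r : ℕ)
    (hc₀ : (Function.support c₀).Finite) (hr : 0 < r)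
    (hchain : ∀ m, m ≤ r → Isol p (run p c₀ i t m) ∧ MultP p (run p c₀ i t m))
    (hridge : ∀ m, m < r → ord (clean p (run p c₀ i t m)) = p) :
    ¬ PairIso p (run p c₀ i t 0) (run p c₀ i t r) := by
  sorry

/-! ## The composition (kernel-checked; no `sorry` in its own term) -/

/-- **`NoPeriodicIsolatedAtom` from the four stub statements** — the assembly, PROVED: descend a
putative periodic isolated chain to a finite field with polynomial start (`stub_descent`); in
dimension `≤ 2` it contradicts `stub_lowDim`; in dimension `≥ 3` every non-final state has order
exactly `p` (`stub_orderWindow` at the consecutive states `m`, `m+1`, using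
`run (m+1) = step (i m) (t m) (run m)` by `rfl`), and the chain contradicts `stub_ridgeAcyclic`.
The conclusion is the route decl by name, through `named_iff`. [cite: HauserPerlega2019, §1 p. 3] -/
theorem NoPeriodicIsolatedAtom_of :
    Sig.stub_descent → Sig.stub_orderWindow → Sig.stub_lowDim → Sig.stub_ridgeAcyclic →
      NoPeriodicIsolatedAtom := by
  intro hD hW hL hR
  refine named_iff.mpr ?_
  intro p hp n hn κ _ _ _ c₀ i t r hr hchain hiso
  obtain ⟨F, _, _, _, c₀', i', t', r', hsupp, hr', hchain', hiso'⟩ :=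
    hD p hp n hn κ c₀ i t r hr hchain hiso
  rcases Nat.lt_or_ge n 3 with hn3 | hn3
  · exact hL p hp n hn (by omega) F c₀' i' t' r' hsupp hr' hchain' hiso'
  · refine hR p hp n hn3 F c₀' i' t' r' hsupp hr' hchain' ?_ hiso'
    intro m hm
    exact hW p hp n hn3 F (run p c₀' i' t' m) (i' m) (t' m) (hchain' m hm.le).2
      (hchain' (m + 1) hm).1 (hchain' (m + 1) hm).2

/-- **The crux `NoPeriodicIsolatedAtom`, assembled from the four registered stubs** (the skeleton in
its final shape; the only `sorry`s in its closure are the four `stub_*`, none of its own). -/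
theorem NoPeriodicIsolatedAtom_proof : NoPeriodicIsolatedAtom :=
  NoPeriodicIsolatedAtom_of stub_descent stub_orderWindow stub_lowDim stub_ridgeAcyclic

end Summit.ResolutionOfSingularities.ResolutionOfSingularities.Cruxes.NoPeriodicIsolatedAtom.Lines.Birth

end
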